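import Summits.ResolutionOfSingularities.ResolutionOfSingularities.Theorems.FrobeniusLadderFInjectiveMacaulayficationStrictTransformChart
import HarnessLib

/-!
# Strict-transform presentation of the point-blow-up charts, with the coordinate dictionary

Support file for crux stmt-ResolutionOfSingularities-15315
(`FrobeniusLadder.FInjectiveMacaulayfication`, line `Sketch`, seat c5): stub
`stub_strictTransformChartDict` of the CALIBRATION package on a non-affine base (second step of
the characteristic-`3` tower on `X₁ = Bl_𝔪 E₈⁰`).

Let `S = k[X₀, X₁, X₂]`, `R = S/(f)` a surface, `π : S → R`, `x j = π(X j)`, `𝔪 = (x₀, x₁, x₂)`,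
`a = x i`. The chart ring `A_i = (R[𝔪t])_{(at)}`
(`HomogeneousLocalization.Away (reesGrading 𝔪) (reesT a _)`) of `Bl_𝔪(Spec R) = Proj R[𝔪t]` is
identified with the affine blowup algebra `R[𝔪/a] ⊆ R[1/a]` by `reesChartEquiv`
(`AffineBlowupAlgebra.lean`), and
`FrobeniusLadderFInjectiveMacaulayficationStrictTransformChart.lean` proves the STRICT TRANSFORM
presentation `A_i ≅ S/(g)` whenever the chart substitution `θ : X i ↦ X i, X j ↦ X j X i (j ≠ i)`
satisfies `θ f = X i ^ μ · g` with `(g)` prime and `X i ∉ (g)`, recording only the value of the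
presentation on the exceptional coordinate `X i ↦ a/1`. Locating the bad point of one chart
relative to the OTHER charts needs the values on ALL coordinates: under the chart map
`reesChart : A_i → R[1/a]` the class of `X j` goes to `x j / a` for `j ≠ i` and to `a` for
`j = i`. We re-run the assembly of that file with this extra bookkeeping, phrased without
denominators: `reesChart (e (X̄ j)) · a = x j` (`j ≠ i`), `reesChart (e (X̄ i)) · 1 = x i`.

Proof layout (all the inputs are the public lemmas of the strict-transform file):
* `reesChart_reesChartEquiv_symm` — `reesChart ∘ reesChartEquiv⁻¹` is the inclusion
  `R[𝔪/a] ⊆ R[1/a]`;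
* `exists_ringEquiv_dict` — the assembly `S/(g) ≅ S/ker ψ ≅ R[𝔪/a] ≅ A_i` for the substitution
  `ψ : X i ↦ a, X j ↦ x j / a`, together with `reesChart ∘ e ∘ (S → S/(g)) = ψ` evaluated on the
  variables;
* `stub_strictTransformChartDict` — the registered stub (`R = S/(f)`, `π` the quotient map,
  `θ = aeval (…)`).

References: The Stacks Project, Tag 0804 (blowing up is `Proj` of the Rees algebra, the charts
`Spec R[I/a]`), Tag 052Q (affine blowup algebras); R. Hartshorne, *Algebraic Geometry*, I.4, and
J. Kollár, *Lectures on Resolution of Singularities*, §2.5 (strict transforms of hypersurfaces under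
point blow-ups) for context; the statement itself is folklore.
-/

-- single-problem summit: the doubled namespace component is forced
set_option linter.dupNamespace false

noncomputable section

namespace Summit.ResolutionOfSingularities.ResolutionOfSingularities.Theorems.FInjectiveMacaulayfication.StrictTransformChartDict

open Literature.AlgebraicGeometry.Resolution MvPolynomial
open Summit.ResolutionOfSingularities.ResolutionOfSingularities.Theorems.FInjectiveMacaulayfication.StrictTransformChart

section Assembly

variable {k : Type*} [CommRing k] {R : Type*} [CommRing R]

/-- `reesChart ∘ reesChartEquiv⁻¹ : R[I/a] → R[1/a]` is the inclusion. [folklore] -/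
theorem reesChart_reesChartEquiv_symm {I : Ideal R} (a : R) (ha : a ∈ I) (z : blowupAlgebra I a) :
    reesChart a ha ((reesChartEquiv a ha).symm z) = z := by
  rw [← coe_reesChartEquiv, RingEquiv.apply_symm_apply]

/-- **Strict-transform presentation of a blow-up chart, with the coordinate dictionary** (abstract
form): for a surjection `π : k[X₀, X₁, X₂] → R` with kernel `(f)`, `x j = π (X j)`,
`𝔪 = (x₀, x₁, x₂)`, and a ring endomorphism `θ` of `k[X₀, X₁, X₂]` fixing constants and `X i` and
sending `X j ↦ X j X i` (`j ≠ i`) with `θ f = X i ^ μ · g`, `(g)` prime, `X i ∉ (g)`: the chart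
ring `(R[𝔪t])_{(x i · t)}` of `Bl_𝔪(Spec R)` is `k[X₀, X₁, X₂]/(g)` by an isomorphism `e` sending
the class of `X i` to `x i / 1` and such that, inside `R[1/x i]`, `reesChart (e (X̄ j)) · x i = x j`
for `j ≠ i` (i.e. `X̄ j ↦ x j / x i`) and `reesChart (e (X̄ i)) = x i`.
[cite: StacksProject, Tag 0804] -/
theorem exists_ringEquiv_dict (π : MvPolynomial (Fin 3) k →+* R) (hπs : Function.Surjective π)
    (x : Fin 3 → R) {i : Fin 3} (hx : ∀ j, x j = π (X j)) {f g : MvPolynomial (Fin 3) k} {μ : ℕ}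
    (hπ : ∀ s, π s = 0 ↔ s ∈ Ideal.span {f}) (hg : (Ideal.span {g}).IsPrime)
    (hXi : X i ∉ Ideal.span {g}) (θ : MvPolynomial (Fin 3) k →+* MvPolynomial (Fin 3) k)
    (hθC : ∀ c : k, θ (C c) = C c) (hθi : θ (X i) = X i)
    (hθj : ∀ j : Fin 3, j ≠ i → θ (X j) = X j * X i) (hθf : θ f = X i ^ μ * g) :
    ∃ e : (MvPolynomial (Fin 3) k ⧸ Ideal.span {g}) ≃+*
        HomogeneousLocalization.Away (reesGrading (Ideal.span (Set.range x)))
          (reesT (x i) (Ideal.subset_span (Set.mem_range_self i))),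
      e (Ideal.Quotient.mk (Ideal.span {g}) (X i)) =
        reesChartBase (x i) (Ideal.subset_span (Set.mem_range_self i)) (x i) ∧
      ∀ j : Fin 3, reesChart (x i) (Ideal.subset_span (Set.mem_range_self i))
          (e (Ideal.Quotient.mk (Ideal.span {g}) (X j))) *
        (if j = i then 1 else algebraMap R (Localization.Away (x i)) (x i)) =
        algebraMap R (Localization.Away (x i)) (x j) := by
  have ha : x i ∈ Ideal.span (Set.range x) := Ideal.subset_span (Set.mem_range_self i)
  -- the substitution `ψ : X i ↦ a, X j ↦ x j / a, c ↦ π c`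
  let ψ : MvPolynomial (Fin 3) k →+* Localization.Away (x i) :=
    MvPolynomial.eval₂Hom ((algebraMap R (Localization.Away (x i))).comp (π.comp MvPolynomial.C))
      fun j => if j = i then algebraMap R (Localization.Away (x i)) (x i)
        else algebraMap R (Localization.Away (x i)) (x j) * IsLocalization.Away.invSelf (x i)
  have hψC : ∀ c, ψ (C c) = algebraMap R (Localization.Away (x i)) (π (C c)) := fun c =>
    MvPolynomial.eval₂Hom_C _ _ c
  have hψi : ψ (X i) = algebraMap R (Localization.Away (x i)) (x i) := by
    simp [ψ]
  have hψj : ∀ j, j ≠ i → ψ (X j) =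
      algebraMap R (Localization.Away (x i)) (x j) * IsLocalization.Away.invSelf (x i) := by
    intro j hj
    simp [ψ, hj]
  have hcomp := comp_eq π x ψ hx hψC hψi hψj θ hθC hθi hθj
  have hι : ∀ r : R, ∃ s, ψ s = algebraMap R (Localization.Away (x i)) r := by
    intro r
    obtain ⟨s, rfl⟩ := hπs r
    exact ⟨θ s, RingHom.congr_fun hcomp s⟩
  have hmem := map_mem_blowupAlgebra π x ψ hψC hψi hψj
  -- `ψ` with codomain restricted to `R[𝔪/a]`: surjective with kernel `(g)`
  let ψ' : MvPolynomial (Fin 3) k →+* blowupAlgebra (Ideal.span (Set.range x)) (x i) :=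
    ψ.codRestrict (blowupAlgebra (Ideal.span (Set.range x)) (x i)).toSubring hmem
  have hsurj : Function.Surjective ψ' := fun z => by
    obtain ⟨s, hs⟩ := exists_map_eq_of_mem_blowupAlgebra x ψ hψj hι z.2
    exact ⟨s, Subtype.ext hs⟩
  have hker : RingHom.ker ψ' = Ideal.span {g} := by
    apply le_antisymm
    · intro h hh
      exact mem_span_of_map_eq_zero π x ψ hx θ hθC hθi hθj hcomp hθf (fun s => (hπ s).mp) hg hXi
        (congrArg Subtype.val (RingHom.mem_ker.mp hh))
    · rw [Ideal.span_le, Set.singleton_subset_iff, SetLike.mem_coe, RingHom.mem_ker]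
      exact Subtype.ext (map_eq_zero_of_transform π x ψ hψi θ hcomp hθf
        ((hπ f).mpr (Ideal.mem_span_singleton_self f)))
  -- the chart map evaluates the assembled isomorphism on the class of `s` to `ψ s`
  have hchart : ∀ s, reesChart (x i) ha (((Ideal.quotEquivOfEq hker.symm).trans
      ((RingHom.quotientKerEquivOfSurjective hsurj).trans (reesChartEquiv (x i) ha).symm))
        (Ideal.Quotient.mk (Ideal.span {g}) s)) = ψ s := by
    intro s
    rw [RingEquiv.trans_apply, RingEquiv.trans_apply, Ideal.quotEquivOfEq_mk,
      RingHom.quotientKerEquivOfSurjective_apply_mk, reesChart_reesChartEquiv_symm]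
    rfl
  refine ⟨(Ideal.quotEquivOfEq hker.symm).trans
    ((RingHom.quotientKerEquivOfSurjective hsurj).trans (reesChartEquiv (x i) ha).symm), ?_,
    fun j => ?_⟩
  · rw [RingEquiv.trans_apply, RingEquiv.trans_apply, Ideal.quotEquivOfEq_mk,
      RingHom.quotientKerEquivOfSurjective_apply_mk, RingEquiv.symm_apply_eq,
      reesChartEquiv_reesChartBase]
    exact Subtype.ext hψi
  · rw [hchart]
    by_cases hj : j = i
    · subst hj
      rw [if_pos rfl, mul_one, hψi]
    · rw [if_neg hj, hψj j hj, div_mul_algebraMap]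

end Assembly

/-- STRICT TRANSFORM CHART DICTIONARY (stub `stub_strictTransformChartDict` of line `Sketch`): for
a surface `R = k[X₀, X₁, X₂]/(f)` with `(f)` prime, `x j` the classes of the variables and
`𝔪 = (x₀, x₁, x₂)`, if the chart substitution `θᵢ : X i ↦ X i, X j ↦ X j X i` gives
`θᵢ f = X i ^ μ · g` with `(g)` prime and `X i ∉ (g)`, then the chart ring `(R[𝔪t])_{(x i · t)}` of
the point blow-up `Bl_𝔪(Spec R)` is `k[X₀, X₁, X₂]/(g)` (the strict transform) by an isomorphism
`e` with `e (X̄ i) = x i / 1` (the exceptional equation) whose composite with the chart map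
`reesChart : (R[𝔪t])_{(x i · t)} → R[1/x i]` is the full coordinate dictionary
`X̄ j ↦ x j / x i` (`j ≠ i`), `X̄ i ↦ x i`, stated denominator-free.
[cite: StacksProject, Tag 0804] -/
theorem stub_strictTransformChartDict : ∀ (k : Type) [Field k] (f g : MvPolynomial (Fin 3) k) (i : Fin 3) (μ : ℕ),
    (Ideal.span {f}).IsPrime → f ≠ 0 → (Ideal.span {g}).IsPrime → MvPolynomial.X i ∉ Ideal.span {g} →
    MvPolynomial.aeval (fun j : Fin 3 => if j = i then (MvPolynomial.X i : MvPolynomial (Fin 3) k)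
        else MvPolynomial.X j * MvPolynomial.X i) f = MvPolynomial.X i ^ μ * g →
    ∀ (x : Fin 3 → MvPolynomial (Fin 3) k ⧸ Ideal.span {f}),
      x = (fun j : Fin 3 => Ideal.Quotient.mk (Ideal.span {f}) (MvPolynomial.X j)) →
      ∃ e : (MvPolynomial (Fin 3) k ⧸ Ideal.span {g}) ≃+*
          HomogeneousLocalization.Away (reesGrading (Ideal.span (Set.range x)))
            (reesT (x i) (Ideal.subset_span (Set.mem_range_self i))),
        e (Ideal.Quotient.mk (Ideal.span {g}) (MvPolynomial.X i)) =
          reesChartBase (x i) (Ideal.subset_span (Set.mem_range_self i)) (x i) ∧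
        ∀ j : Fin 3, reesChart (x i) (Ideal.subset_span (Set.mem_range_self i))
            (e (Ideal.Quotient.mk (Ideal.span {g}) (MvPolynomial.X j))) *
          (if j = i then 1 else algebraMap _ (Localization.Away (x i)) (x i)) =
          algebraMap _ (Localization.Away (x i)) (x j) := by
  intro k _ f g i μ _ _ hg hXi hθf x hx
  exact exists_ringEquiv_dict (Ideal.Quotient.mk (Ideal.span {f})) Ideal.Quotient.mk_surjective x
    (fun j => congrFun hx j) (fun s => Ideal.Quotient.eq_zero_iff_mem) hg hXi
    (MvPolynomial.aeval fun j : Fin 3 =>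
      if j = i then (X i : MvPolynomial (Fin 3) k) else X j * X i).toRingHom
    (fun c => MvPolynomial.algHom_C _ c) ((MvPolynomial.aeval_X _ i).trans (if_pos rfl))
    (fun j hj => (MvPolynomial.aeval_X _ j).trans (if_neg hj)) hθf

end Summit.ResolutionOfSingularities.ResolutionOfSingularities.Theorems.FInjectiveMacaulayfication.StrictTransformChartDict

end
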